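import Mathlib.Algebra.BigOperators.Finprod
import Mathlib.Algebra.FiniteSupport.Basic
import Mathlib.LinearAlgebra.Matrix.SpecialLinearGroup
import Mathlib.Data.Int.Interval
import HarnessLib

/-!
# Crux `ThetaLayerLambdaCongruenceAtTwo` (stmt-BirchSwinnertonDyer-20688, route ResidualThetaTransportAtTwo), line
# `birth` v14 — SD floor, kernel road, Hecke clause of IP, brick HA6 «KAPPA CANCELLATION» of
# `Cruxes/ThetaLayerLambdaCongruenceAtTwo/Lines/birth-sd2-hecke-adjoint.md` §3 (E) / §4 (lead g13's split 18:35Z: w2 g8)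
# (width seat bsd-wall-rtt-p3-w2 g8; `--supports stmt-BirchSwinnertonDyer-20688 --as helper`; closes nothing)

HONEST FRAMING. Elementary THEOREMS about finitely supported sums over groups and about finite sets of `2×2` integer matrices; no
definition; nothing about any curve or form is asserted; BSD is not proved by any of this; Kan⁺ 20688 is not settled by this file.

WHAT. In step (E) of the Hecke-adjointness plan the Jordan correction enters as
  `Σ_M Σ_g Σ'_{u ∈ Γ₀(N)} [κ_{Mg}(u⁻¹γ) − κ_{Mg}(u⁻¹)]`,  `γ ∈ Γ₀(N)`,
where `κ_C : SL₂(ℤ) → ℤ` has FINITE support (brick HA5: it vanishes off the finitely many flags sitting at the vertices of the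
re-expansion polygon of `C` and pointing into it). The correction VANISHES: re-index `u ↦ γ⁻¹u`. This file proves exactly that, for an
ARBITRARY finitely supported `κ` on an arbitrary group (so that any spelling of `κ_C` plugs in by `fun A ↦ …`):
* `finsum_subgroup_inv_mul_eq` — `∑ᶠ u : Γ, κ(u⁻¹γ) = ∑ᶠ u : Γ, κ(u⁻¹)` (no finiteness needed: a bijection of the index type);
* `hasFiniteSupport_subgroup_inv_mul` — `u ↦ κ(u⁻¹g)` is finitely supported on `Γ` when `κ` is on `G`;
* `finsum_subgroup_kappa_sub_eq_zero` — `∑ᶠ u : Γ, (κ(u⁻¹γ) − κ(u⁻¹)) = 0`; `…_indicator_…` — the same summed over `G` with the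
  indicator of `Γ`; `list_sum_finsum_kappa_sub_eq_zero` / `finset_sum_…` — summed over an outer list / finset (the `Σ_M Σ_g`);
* `finsum_eq_two_nsmul_sum_half` — the `±` double count: if `−1 ∈ Γ` acts without fixed points and `κ(−A) = κ(A)` then the
  full `Γ`-sum is twice the sum over any `±`-transversal given as a finset containing the support (bookkeeping for `Σ'_{u ∈ Γ₀/±}`);
* finiteness utilities for HA5c: `sl2_setOf_entry_bound_finite` (`{A ∈ SL₂(ℤ) : |A i j| ≤ K}` is finite) and
  `sl2_flags_at_cusp_finite` (`{±k Tⁿ : n₁ ≤ n ≤ n₂}` is finite), `hasFiniteSupport_of_subset_finite`.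
References: [Merel1994] §1.3 (finiteness of Heilbronn-type sums); [CremonaAlgorithms1997] §2.2.
-/

open scoped MatrixGroups

open Function

namespace Summit.BirchSwinnertonDyer.BirchSwinnertonDyer.Theorems.ThetaLayerLambdaCongruenceAtTwo

universe u v

/-! ## §1. Re-indexing over a subgroup -/

section Reindex

variable {G : Type u} [Group G] {M : Type v} [AddCommGroup M]

/-- **Re-indexing `u ↦ γ⁻¹u`.** For a subgroup `Γ ≤ G`, `γ ∈ Γ` and ANY `κ : G → M`:
`∑ᶠ u : Γ, κ(u⁻¹ γ) = ∑ᶠ u : Γ, κ(u⁻¹)` (left multiplication by `γ⁻¹` is a bijection of `Γ`; `finsum` needs no finiteness for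
this). [cite: Merel1994, §1.3] -/
theorem finsum_subgroup_inv_mul_eq (Γ : Subgroup G) {γ : G} (hγ : γ ∈ Γ) (κ : G → M) :
    ∑ᶠ u : Γ, κ ((u : G)⁻¹ * γ) = ∑ᶠ u : Γ, κ ((u : G)⁻¹) := by
  -- `e u = γ u`, so `(e u)⁻¹ γ = u⁻¹ γ⁻¹ γ = u⁻¹`
  let e : Γ ≃ Γ := Equiv.mulLeft (⟨γ, hγ⟩ : Γ)
  have h := finsum_comp_equiv e (f := fun u : Γ ↦ κ ((u : G)⁻¹ * γ))
  rw [← h]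
  refine finsum_congr fun u ↦ ?_
  simp [e, mul_assoc]

/-- **Finite support transfers to `u ↦ κ(u⁻¹ g)` on a subgroup.** [folklore] -/
theorem hasFiniteSupport_subgroup_inv_mul (Γ : Subgroup G) (g : G) {κ : G → M} (hκ : κ.HasFiniteSupport) :
    (fun u : Γ ↦ κ ((u : G)⁻¹ * g)).HasFiniteSupport := by
  have hinj : Injective (fun u : Γ ↦ (u : G)⁻¹ * g) := by
    intro u v huv
    have : (u : G)⁻¹ = (v : G)⁻¹ := mul_right_cancel huv
    exact Subtype.ext (inv_injective this)
  exact hκ.fun_comp_of_injective hinj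

/-- The special case `g = 1`: `u ↦ κ(u⁻¹)` is finitely supported on `Γ`. [folklore] -/
theorem hasFiniteSupport_subgroup_inv (Γ : Subgroup G) {κ : G → M} (hκ : κ.HasFiniteSupport) :
    (fun u : Γ ↦ κ ((u : G)⁻¹)).HasFiniteSupport := by
  have h := hasFiniteSupport_subgroup_inv_mul Γ 1 hκ
  simp only [mul_one] at h
  exact h

/-- **HA6 — the Jordan correction cancels.** For a subgroup `Γ ≤ G`, `γ ∈ Γ` and a FINITELY SUPPORTED `κ : G → M`:
`∑ᶠ u : Γ, (κ(u⁻¹γ) − κ(u⁻¹)) = 0` (split the finitely supported difference and re-index the first sum by `u ↦ γ⁻¹u`).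
In the plan: `κ = κ_C`, the Jordan correction of the re-expansion of the generalised edge `C·{∞,0}`, finitely supported by HA5;
`Γ = Γ₀(N)`, `γ` the loop of the dual chain. [cite: Merel1994, §1.3] -/
theorem finsum_subgroup_kappa_sub_eq_zero (Γ : Subgroup G) {γ : G} (hγ : γ ∈ Γ) {κ : G → M}
    (hκ : κ.HasFiniteSupport) :
    ∑ᶠ u : Γ, (κ ((u : G)⁻¹ * γ) - κ ((u : G)⁻¹)) = 0 := by
  rw [finsum_sub_distrib (hasFiniteSupport_subgroup_inv_mul Γ γ hκ) (hasFiniteSupport_subgroup_inv Γ hκ),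
    finsum_subgroup_inv_mul_eq Γ hγ κ, sub_self]

/-- The same with a second base point: `∑ᶠ u : Γ, (κ(u⁻¹γg) − κ(u⁻¹g)) = 0` for `γ ∈ Γ`, `g ∈ G` arbitrary
(apply the previous statement to `A ↦ κ(A g)`). [cite: Merel1994, §1.3] -/
theorem finsum_subgroup_kappa_sub_eq_zero' (Γ : Subgroup G) {γ : G} (hγ : γ ∈ Γ) (g : G) {κ : G → M}
    (hκ : κ.HasFiniteSupport) :
    ∑ᶠ u : Γ, (κ ((u : G)⁻¹ * γ * g) - κ ((u : G)⁻¹ * g)) = 0 := by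
  have hκ' : (fun A : G ↦ κ (A * g)).HasFiniteSupport :=
    hκ.fun_comp_of_injective (mul_left_injective g)
  have h := finsum_subgroup_kappa_sub_eq_zero Γ hγ hκ'
  simpa using h

/-- **Indicator spelling.** Summing over the ambient group with the indicator of `Γ`:
`∑ᶠ u : G, (if u ∈ Γ then κ(u⁻¹γ) − κ(u⁻¹) else 0) = 0`. [cite: Merel1994, §1.3] -/
theorem finsum_indicator_kappa_sub_eq_zero (Γ : Subgroup G) [DecidablePred (· ∈ Γ)] {γ : G} (hγ : γ ∈ Γ)
    {κ : G → M} (hκ : κ.HasFiniteSupport) :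
    ∑ᶠ u : G, (if u ∈ Γ then κ (u⁻¹ * γ) - κ u⁻¹ else 0) = 0 := by
  have h := finsum_subgroup_kappa_sub_eq_zero Γ hγ hκ
  have e : (∑ᶠ u : G, if u ∈ Γ then κ (u⁻¹ * γ) - κ u⁻¹ else 0) =
      ∑ᶠ (u : G) (_ : u ∈ Γ), (fun v : G ↦ κ (v⁻¹ * γ) - κ v⁻¹) u :=
    finsum_congr fun u ↦ finsum_eq_if.symm
  rw [e, ← finsum_subtype_eq_finsum_cond]
  exact h

/-- **Summed over an outer list** (the `Σ_g` over a Manin chain in memo (D)): a list of such corrections sums to `0`.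
[cite: Merel1994, §1.3] -/
theorem list_sum_finsum_kappa_sub_eq_zero {ι : Type*} (Γ : Subgroup G) {γ : G} (hγ : γ ∈ Γ) (L : List ι)
    (κ : ι → G → M) (hκ : ∀ i ∈ L, (κ i).HasFiniteSupport) :
    (L.map fun i ↦ ∑ᶠ u : Γ, (κ i ((u : G)⁻¹ * γ) - κ i ((u : G)⁻¹))).sum = 0 := by
  rw [List.map_congr_left (fun i hi ↦ finsum_subgroup_kappa_sub_eq_zero Γ hγ (hκ i hi))]
  simp

/-- **Summed over an outer finset** (the `Σ_M` over coset representatives in memo (D)). [cite: Merel1994, §1.3] -/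
theorem finset_sum_finsum_kappa_sub_eq_zero {ι : Type*} (Γ : Subgroup G) {γ : G} (hγ : γ ∈ Γ) (s : Finset ι)
    (κ : ι → G → M) (hκ : ∀ i ∈ s, (κ i).HasFiniteSupport) :
    ∑ i ∈ s, ∑ᶠ u : Γ, (κ i ((u : G)⁻¹ * γ) - κ i ((u : G)⁻¹)) = 0 :=
  Finset.sum_eq_zero fun i hi ↦ finsum_subgroup_kappa_sub_eq_zero Γ hγ (hκ i hi)

end Reindex

/-! ## §2. Finite support: utilities for the flags at the vertices (input side of HA5c) -/

section Finite

/-- A function supported inside a finite set has finite support. [folklore] -/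
theorem hasFiniteSupport_of_subset_finite {α : Type u} {M : Type v} [Zero M] {κ : α → M} {s : Set α}
    (hs : s.Finite) (h : ∀ a, κ a ≠ 0 → a ∈ s) : κ.HasFiniteSupport :=
  hs.subset fun a ha ↦ h a ha

/-- **Finitely many matrices of `SL₂(ℤ)` with bounded entries**: `{A : |A i j| ≤ K ∀ i j}` is finite (it injects into a product of
four integer intervals). [folklore] -/
theorem sl2_setOf_entry_bound_finite (K : ℤ) :
    {A : SL(2, ℤ) | ∀ i j, |A i j| ≤ K}.Finite := by
  let box : Set (Fin 2 → Fin 2 → ℤ) := Set.univ.pi fun _ ↦ Set.univ.pi fun _ ↦ Set.Icc (-K) K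
  have hbox : box.Finite :=
    Set.Finite.pi fun _ ↦ Set.Finite.pi fun _ ↦ Set.finite_Icc (-K) K
  have hmap : Set.MapsTo (fun A : SL(2, ℤ) ↦ fun i j ↦ A i j) {A : SL(2, ℤ) | ∀ i j, |A i j| ≤ K} box := by
    intro A hA
    simp only [box, Set.mem_pi, Set.mem_univ, true_implies, Set.mem_Icc]
    exact fun i j ↦ abs_le.mp (hA i j)
  refine Set.Finite.of_injOn hmap ?_ hbox
  intro A _ B _ hAB
  ext i j
  exact congrFun (congrFun hAB i) j

/-- **Finitely many flags at a cusp with a bounded direction window**: for `k ∈ SL₂(ℤ)` and `n₁ ≤ n₂` the set of matrices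
`± k Tⁿ`, `n₁ ≤ n ≤ n₂` — the flags based at the cusp `k∞` whose direction index lies in the window — is finite.
(`T = (1 1; 0 1)`.) [cite: Manin1972, §1.5] -/
theorem sl2_flags_at_cusp_finite (k : SL(2, ℤ)) (n₁ n₂ : ℤ) :
    {A : SL(2, ℤ) | ∃ n : ℤ, n₁ ≤ n ∧ n ≤ n₂ ∧
      (A = k * ModularGroup.T ^ n ∨ A = -(k * ModularGroup.T ^ n))}.Finite := by
  have h : {A : SL(2, ℤ) | ∃ n : ℤ, n₁ ≤ n ∧ n ≤ n₂ ∧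
      (A = k * ModularGroup.T ^ n ∨ A = -(k * ModularGroup.T ^ n))} ⊆
      ((fun n : ℤ ↦ k * ModularGroup.T ^ n) '' Set.Icc n₁ n₂) ∪
        ((fun n : ℤ ↦ -(k * ModularGroup.T ^ n)) '' Set.Icc n₁ n₂) := by
    rintro A ⟨n, h1, h2, hA | hA⟩
    · exact Or.inl ⟨n, ⟨h1, h2⟩, hA.symm⟩
    · exact Or.inr ⟨n, ⟨h1, h2⟩, hA.symm⟩
  exact Set.Finite.subset (Set.Finite.union (Set.Finite.image _ (Set.finite_Icc n₁ n₂))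
    (Set.Finite.image _ (Set.finite_Icc n₁ n₂))) h

/-- **Finite support from a vertex/window description** (the shape HA5 produces): if `κ(A) ≠ 0` forces `A = ±k_v Tⁿ` for a vertex
anchor `k_v` from a finite list and a direction `n` in a window `[n₁ v, n₂ v]`, then `κ` has finite support. [cite: Manin1972, §1.5] -/
theorem hasFiniteSupport_of_flags_at_vertices {M : Type v} [Zero M] (κ : SL(2, ℤ) → M) (V : List SL(2, ℤ))
    (n₁ n₂ : SL(2, ℤ) → ℤ)
    (h : ∀ A, κ A ≠ 0 → ∃ k ∈ V, ∃ n : ℤ, n₁ k ≤ n ∧ n ≤ n₂ k ∧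
      (A = k * ModularGroup.T ^ n ∨ A = -(k * ModularGroup.T ^ n))) :
    κ.HasFiniteSupport := by
  refine hasFiniteSupport_of_subset_finite (s := ⋃ k ∈ V.toFinset, {A : SL(2, ℤ) | ∃ n : ℤ, n₁ k ≤ n ∧ n ≤ n₂ k ∧
      (A = k * ModularGroup.T ^ n ∨ A = -(k * ModularGroup.T ^ n))}) ?_ ?_
  · exact Set.Finite.biUnion (Finset.finite_toSet _) fun k _ ↦ sl2_flags_at_cusp_finite k (n₁ k) (n₂ k)
  · intro A hA
    obtain ⟨k, hk, n, h1, h2, hAk⟩ := h A hA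
    simp only [Set.mem_iUnion, Set.mem_setOf_eq]
    exact ⟨k, List.mem_toFinset.mpr hk, n, h1, h2, hAk⟩

end Finite

/-! ## §3. The `±` double count -/

section PlusMinus

variable {M : Type v} [AddCommGroup M]

/-- **`±` bookkeeping.** On a subgroup `Γ ≤ SL₂(ℤ)` containing `−1`, for a sign-invariant finitely supported summand
`φ(−u) = φ(u)`, the full sum is twice the sum over the «positive» half of any finset `s ⊇ support` that is `±`-symmetric and split
by a fixed-point-free choice of halves: concretely, if `s = sPos ∪ (−sPos)` with `sPos ∩ (−sPos) = ∅`, then `∑ᶠ u : Γ, φ u = 2 • ∑ u ∈ sPos, φ u`.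
(This is the factor hidden in `Σ'_{u ∈ Γ₀/±}`.) [cite: Merel1994, §1.3] -/
theorem finsum_eq_two_nsmul_sum_half {Γ : Subgroup SL(2, ℤ)} (φ : Γ → M) (hφ : ∀ u : Γ, ∀ h : -(u : SL(2, ℤ)) ∈ Γ,
      φ ⟨-(u : SL(2, ℤ)), h⟩ = φ u)
    (hneg : ∀ u : Γ, -(u : SL(2, ℤ)) ∈ Γ) (sPos : Finset Γ)
    (hdisj : ∀ u ∈ sPos, (⟨-(u : SL(2, ℤ)), hneg u⟩ : Γ) ∉ sPos)
    (hsupp : ∀ u : Γ, φ u ≠ 0 → u ∈ sPos ∨ (⟨-(u : SL(2, ℤ)), hneg u⟩ : Γ) ∈ sPos) :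
    ∑ᶠ u : Γ, φ u = 2 • ∑ u ∈ sPos, φ u := by
  classical
  -- the negation map on `Γ`
  let ng : Γ → Γ := fun u ↦ ⟨-(u : SL(2, ℤ)), hneg u⟩
  have hng : ∀ u, ng (ng u) = u := fun u ↦ by ext1; simp [ng]
  have hng_inj : Function.Injective ng := fun u v h ↦ by rw [← hng u, ← hng v, h]
  -- support ⊆ sPos ∪ ng '' sPos
  have hs : φ.support ⊆ ↑(sPos ∪ sPos.image ng) := by
    intro u hu
    rcases hsupp u hu with h | h
    · exact Finset.mem_coe.mpr (Finset.mem_union_left _ h)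
    · refine Finset.mem_coe.mpr (Finset.mem_union_right _ ?_)
      exact Finset.mem_image.mpr ⟨ng u, h, hng u⟩
  rw [finsum_eq_sum_of_support_subset φ hs,
    Finset.sum_union (Finset.disjoint_left.mpr fun u hu hu' ↦ ?_), Finset.sum_image fun u _ v _ h ↦ hng_inj h]
  · have e : ∑ u ∈ sPos, φ (ng u) = ∑ u ∈ sPos, φ u := Finset.sum_congr rfl fun u _ ↦ hφ u (hneg u)
    rw [e, two_nsmul]
  · obtain ⟨v, hv, rfl⟩ := Finset.mem_image.mp hu'
    exact hdisj v hv hu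

end PlusMinus

end Summit.BirchSwinnertonDyer.BirchSwinnertonDyer.Theorems.ThetaLayerLambdaCongruenceAtTwo
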